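/-
Copyright (c) 2026 the pub-hodgecm-mathlib formalisation cell (harness21).  Prover seat hodgecm-mathlib-K2E1-p10 (g2), Track B ∕ K2-LIT (build stream 29), h413 = `stmt-HodgeConjecture-24833`,
route of record `HCCMUnconditional`, ROADCARD «5Res ENDGAME BY FAMILIES» §2 C7; dealer K2E1-plan (g7) deals (217)∕(232) — FILE F3d-γ of the C7 split: THE SUP-NORM BAND BOUND
`‖[quotFun (E δ)]‖₂ ≤ μ(X)^{1/2} · C_a · sup|δ|` for `δ` vanishing below height `a`.
-/
import Summits.HodgeConjecture.HodgeConjecture.Theorems.K2E1BLReductionCoveringU2     -- ★ (K2E1-p08): `exists_ncard_setOf_lt_borelHeight_le_cm` (uniform count), transitively ★ `finite_setOf_lt_borelHeight_two`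
import Summits.HodgeConjecture.HodgeConjecture.Theorems.K2E1BorelCosetsDictionary      -- ★ (K2E1-p08): `eisensteinSeriesU_eq_tsum_arithmeticBorelQuot`
import Literature.NumberTheory.Automorphic.AutomorphicRepsGLCuspidalUnitary          -- ★ `AdelicGroupData.quotFun`, `norm_quotFun_le`
import HarnessLib

/-!
# h413 ∕ Track B «K2-LIT», ROADCARD «5Res BY FAMILIES» C7, FILE F3d-γ — helper `K2E1EisensteinSupNormBandBoundCMTwo`: for `δ` left-`B(F)`-invariant, vanishing where `H ≤ a` (`a > 0`) and
# `|δ| ≤ ε`: `E δ (g)` is a FINITE sum over `{q : a < H(q̃ g)}`, `|E δ| ≤ C_a ε` UNIFORMLY (★ `exists_ncard_setOf_lt_borelHeight_le_cm`), hence `‖[quotFun (E δ)]‖_{L²(X,μ)} ≤ μ(X)^{1/2} C_a ε`,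
# and the same for `δ = ψ − Σ_j a_j ψ_j` at the level of `L²`-classes

Cell `pub/hodgecm-mathlib`, crux h413 = `stmt-HodgeConjecture-24833`, route of record `HCCMUnconditional`; dealer K2E1-plan (g7) (232).  THEOREMS ONLY (no `def`, no `instance`, no notation, no
named-fact hypothesis, no `sorry`); lane `--supports stmt-HodgeConjecture-24833 --as helper` (count-neutral).  Closes no socket.  §1 generic quadratic datum `(F, E, c)`, `U(J₂)`; §2–§3 the CM
pair `(L⁺, L)` (the uniform count ★ `exists_ncard_setOf_lt_borelHeight_le_cm` is typed there).

THE MATHEMATICS ([MoeglinWaldspurger1995, II.1.2, I.2.2]; [BernsteinLapid2019, §4]; [Garrett2018, §2.3]).  If `δ : G(𝔸) → ℂ` is left-`B(F)`-invariant and `δ(g) = 0` whenever `H(g) ≤ a`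
(`a > 0`; e.g. `δ` supported in `N(𝔸)B(F)·C`, `C` compact), then at every `g` only the finitely many cosets `q ∈ B(F)∖G(F)` with `a < H(q̃ g)` contribute to `E δ (g) = Σ'_q δ(q̃ g)`
(★ `finite_setOf_lt_borelHeight_two`), so `E δ (g) = Σ_{q : a < H(q̃g)} δ(q̃ g)` is a finite sum, LINEAR in `δ` on this class, and `|E δ (g)| ≤ #{q : a < H(q̃ g)} · sup|δ| ≤ C_a · sup|δ|` with
the UNIFORM constant of ★ `exists_ncard_setOf_lt_borelHeight_le_cm`; on the automorphic quotient (`μ` finite) `‖[quotFun (E δ)]‖₂ ≤ μ(X)^{1/2} · C_a · sup|δ|` (Mathlib `Lp.norm_le_of_ae_bound`).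
This is the estimate that carries ★ F3c's UNIFORM approximation `sup|ψ − Σ a_χ P_χ ψ| ≤ ε` to `L²(X)`: `‖[E ψ] − Σ a_χ [E P_χψ]‖₂ ≤ μ(X)^{1/2} C_a ε` (§3).

* §1 `eisensteinSeriesU_eq_finset_sum_of_band`, `eisensteinSeriesU_sub_finset_sum_of_band` (linearity on the class), `norm_eisensteinSeriesU_le_ncard_mul`.
* §2 `exists_const_norm_eisensteinSeriesU_le_cm` (uniform `C_a`), `norm_toLp_quotFun_le_of_forall_norm_le`.  §3 **`exists_const_norm_toLp_sub_sum_le_cm`** (the `L²` transfer for finite sums).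

HONEST LABEL: HC_CM is proved only modulo the 7 printed citations (2 remaining named inputs: hLiu418 = `stmt-HodgeConjecture-24832`, h413 = `stmt-HodgeConjecture-24833`) until rung 0
closes; this file asserts no named fact and closes no socket.
References: [MoeglinWaldspurger1995] C. Mœglin, J.-L. Waldspurger, *Spectral Decomposition and Eisenstein Series*, I.2.2, II.1.2; [BernsteinLapid2019] J. Bernstein, E. Lapid, *On the
meromorphic continuation of Eisenstein series*, §4; [Garrett2018] P. Garrett, *Modern Analysis of Automorphic Forms by Example*, §2.3.
-/

set_option autoImplicit false
set_option linter.dupNamespace false  -- the mandated namespace repeats the summit's segment (`HodgeConjecture.HodgeConjecture`)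

noncomputable section

open MeasureTheory Measure Set Filter Topology NumberField
open Literature.NumberTheory.Automorphic Literature.NumberTheory.Automorphic.UnitaryGroup AdelicGroupData
open Summit.HodgeConjecture.HodgeConjecture.Cruxes.H413.K2E1BorelEisensteinU
open Summit.HodgeConjecture.HodgeConjecture.Cruxes.H413.K2E1BorelCosetsDictionary (eisensteinSeriesU_eq_tsum_arithmeticBorelQuot)
open Summit.HodgeConjecture.HodgeConjecture.Cruxes.H413.K2E1BLReductionCoveringU2 (exists_ncard_setOf_lt_borelHeight_le_cm)
open scoped ENNReal NNReal

namespace Summit.HodgeConjecture.HodgeConjecture.Cruxes.H413.K2E1EisensteinSupNormBandBoundCMTwo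

/-! ## §1 Generic `(F, E, c)`, `U(J₂)`: `E δ` is a finite sum for `δ` vanishing below height `a` -/

section Generic

variable {F E : Type} [Field F] [NumberField F] [Field E] [NumberField E] [Algebra F E] {c : E ≃ₐ[F] E}

/-- **`E δ (g) = Σ_{q : a < H(q̃ g)} δ(q̃ g)`**, a FINITE sum (★ `finite_setOf_lt_borelHeight_two`), for `δ` left-`B(F)`-invariant and vanishing where `H ≤ a`, `a > 0`.
[cite: MoeglinWaldspurger1995, II.1.2, I.2.2] -/
theorem eisensteinSeriesU_eq_finset_sum_of_band {δ : (quasiSplit F E c 2).Adelic → ℂ}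
    (hδB : ∀ b ∈ arithmeticBorel F E c 2, ∀ x : (quasiSplit F E c 2).Adelic, δ ((b : (quasiSplit F E c 2).Adelic) * x) = δ x)
    {a : ℝ≥0} (ha : 0 < a) (hδa : ∀ g : (quasiSplit F E c 2).Adelic, borelHeight g ≤ a → δ g = 0) (g : (quasiSplit F E c 2).Adelic) :
    eisensteinSeriesU δ g = ∑ q ∈ (finite_setOf_lt_borelHeight_two g ha).toFinset, δ (((q.out : (quasiSplit F E c 2).arithmeticSubgroup) : (quasiSplit F E c 2).Adelic) * g) := by
  rw [eisensteinSeriesU_eq_tsum_arithmeticBorelQuot hδB g]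
  refine tsum_eq_sum fun q hq => hδa _ (not_lt.1 fun hlt => hq ?_)
  exact (Set.Finite.mem_toFinset _).2 hlt

/-- **LINEARITY ON THE CLASS**: `E(ψ − Σ_{j∈s} a_j ψ_j)(g) = E ψ (g) − Σ_{j∈s} a_j E ψ_j (g)` when `ψ` and the `ψ_j` are left-`B(F)`-invariant and vanish where `H ≤ a` (all finite sums over the same finite set).
[cite: MoeglinWaldspurger1995, II.1.2] -/
theorem eisensteinSeriesU_sub_finset_sum_of_band {ι' : Type*} (s : Finset ι') (a' : ι' → ℂ) {ψ : (quasiSplit F E c 2).Adelic → ℂ} {ψ' : ι' → (quasiSplit F E c 2).Adelic → ℂ}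
    (hψB : ∀ b ∈ arithmeticBorel F E c 2, ∀ x : (quasiSplit F E c 2).Adelic, ψ ((b : (quasiSplit F E c 2).Adelic) * x) = ψ x)
    (hψ'B : ∀ j, ∀ b ∈ arithmeticBorel F E c 2, ∀ x : (quasiSplit F E c 2).Adelic, ψ' j ((b : (quasiSplit F E c 2).Adelic) * x) = ψ' j x)
    {a : ℝ≥0} (ha : 0 < a) (hψa : ∀ g : (quasiSplit F E c 2).Adelic, borelHeight g ≤ a → ψ g = 0) (hψ'a : ∀ j (g : (quasiSplit F E c 2).Adelic), borelHeight g ≤ a → ψ' j g = 0)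
    (g : (quasiSplit F E c 2).Adelic) :
    eisensteinSeriesU (fun x => ψ x - ∑ j ∈ s, a' j * ψ' j x) g = eisensteinSeriesU ψ g - ∑ j ∈ s, a' j * eisensteinSeriesU (ψ' j) g := by
  have hδB : ∀ b ∈ arithmeticBorel F E c 2, ∀ x : (quasiSplit F E c 2).Adelic,
      (fun x => ψ x - ∑ j ∈ s, a' j * ψ' j x) ((b : (quasiSplit F E c 2).Adelic) * x) = (fun x => ψ x - ∑ j ∈ s, a' j * ψ' j x) x := fun b hb x => by
    simp only [hψB b hb x, hψ'B _ b hb x]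
  have hδa : ∀ g : (quasiSplit F E c 2).Adelic, borelHeight g ≤ a → (fun x => ψ x - ∑ j ∈ s, a' j * ψ' j x) g = 0 := fun g hg => by
    simp only [hψa g hg, hψ'a _ g hg, mul_zero, Finset.sum_const_zero, sub_zero]
  rw [eisensteinSeriesU_eq_finset_sum_of_band hδB ha hδa g, eisensteinSeriesU_eq_finset_sum_of_band hψB ha hψa g]
  simp only [eisensteinSeriesU_eq_finset_sum_of_band (hψ'B _) ha (hψ'a _) g, Finset.sum_sub_distrib, Finset.mul_sum]
  rw [Finset.sum_comm]

/-- **`|E δ (g)| ≤ #{q : a < H(q̃ g)} · ε`** for `|δ| ≤ ε`, `δ` left-`B(F)`-invariant vanishing where `H ≤ a`. [cite: MoeglinWaldspurger1995, I.2.2] -/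
theorem norm_eisensteinSeriesU_le_ncard_mul {δ : (quasiSplit F E c 2).Adelic → ℂ}
    (hδB : ∀ b ∈ arithmeticBorel F E c 2, ∀ x : (quasiSplit F E c 2).Adelic, δ ((b : (quasiSplit F E c 2).Adelic) * x) = δ x)
    {a : ℝ≥0} (ha : 0 < a) (hδa : ∀ g : (quasiSplit F E c 2).Adelic, borelHeight g ≤ a → δ g = 0) {ε : ℝ} (hε : ∀ g, ‖δ g‖ ≤ ε) (g : (quasiSplit F E c 2).Adelic) :
    ‖eisensteinSeriesU δ g‖ ≤ ({q : Quotient (QuotientGroup.rightRel (arithmeticBorel F E c 2)) |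
        a < borelHeight (((q.out : (quasiSplit F E c 2).arithmeticSubgroup) : (quasiSplit F E c 2).Adelic) * g)}.ncard : ℝ) * ε := by
  rw [eisensteinSeriesU_eq_finset_sum_of_band hδB ha hδa g, Set.ncard_eq_toFinset_card _ (finite_setOf_lt_borelHeight_two g ha)]
  calc ‖∑ q ∈ (finite_setOf_lt_borelHeight_two g ha).toFinset, δ (((q.out : (quasiSplit F E c 2).arithmeticSubgroup) : (quasiSplit F E c 2).Adelic) * g)‖
      ≤ ∑ q ∈ (finite_setOf_lt_borelHeight_two g ha).toFinset, ε := (norm_sum_le _ _).trans (Finset.sum_le_sum fun q _ => hε _)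
    _ = _ := by rw [Finset.sum_const, nsmul_eq_mul]

end Generic

/-! ## §2 The CM pair: the uniform constant and the `L²` bound -/

section CM

variable (L : Type) [Field L] [NumberField L] [IsCMField L]

/-- **UNIFORM SUP BOUND `|E δ| ≤ C_a · ε`** for the CM pair: one constant `C_a` for ALL left-`B(F)`-invariant `δ` vanishing where `H ≤ a` with `|δ| ≤ ε` (★ `exists_ncard_setOf_lt_borelHeight_le_cm`).
[cite: BernsteinLapid2019, §4] [cite: MoeglinWaldspurger1995, I.2.2] -/
theorem exists_const_norm_eisensteinSeriesU_le_cm {a : ℝ≥0} (ha : 0 < a) :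
    ∃ C : ℝ, 0 ≤ C ∧ ∀ (δ : (quasiSplit (↥(maximalRealSubfield L)) L (IsCMField.complexConj L) 2).Adelic → ℂ)
      (_ : ∀ b ∈ arithmeticBorel (↥(maximalRealSubfield L)) L (IsCMField.complexConj L) 2, ∀ x, δ ((b : (quasiSplit (↥(maximalRealSubfield L)) L (IsCMField.complexConj L) 2).Adelic) * x) = δ x)
      (_ : ∀ g, borelHeight g ≤ a → δ g = 0) (ε : ℝ) (_ : ∀ g, ‖δ g‖ ≤ ε) (g : (quasiSplit (↥(maximalRealSubfield L)) L (IsCMField.complexConj L) 2).Adelic),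
        ‖eisensteinSeriesU δ g‖ ≤ C * ε := by
  obtain ⟨C, hC⟩ := exists_ncard_setOf_lt_borelHeight_le_cm L ha
  refine ⟨C, C.cast_nonneg, fun δ hδB hδa ε hε g => (norm_eisensteinSeriesU_le_ncard_mul hδB ha hδa hε g).trans ?_⟩
  have hε0 : 0 ≤ ε := (norm_nonneg _).trans (hε 1)
  exact mul_le_mul_of_nonneg_right (by exact_mod_cast hC g) hε0

/-- **`‖[quotFun φ]‖_{L²(X,μ)} ≤ μ(X)^{1/2} · M`** for `|φ| ≤ M` (any adelic group datum, any finite `μ`; Mathlib `Lp.norm_le_of_ae_bound`). [cite: MoeglinWaldspurger1995, I.2.13] -/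
theorem norm_toLp_quotFun_le_of_forall_norm_le {K : Type} [Field K] [NumberField K] (𝒢 : AdelicGroupData K) (μ : Measure 𝒢.automorphicQuotient) [IsFiniteMeasure μ]
    {φ : 𝒢.Adelic → ℂ} {M : ℝ} (hM0 : 0 ≤ M) (hM : ∀ g, ‖φ g‖ ≤ M) (hv : MemLp (𝒢.quotFun φ) 2 μ) :
    ‖hv.toLp _‖ ≤ (measureUnivNNReal μ : ℝ) ^ (2 : ℝ)⁻¹ * M := by
  have h := Lp.norm_le_of_ae_bound (f := hv.toLp _) hM0 ?_
  · simpa only [ENNReal.toReal_ofNat] using h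
  · filter_upwards [hv.coeFn_toLp] with x hx
    rw [hx]; exact norm_quotFun_le hM x

end CM

/-! ## §3 The `L²` transfer for `ψ − Σ_j a_j ψ_j` -/

section Transfer

variable (L : Type) [Field L] [NumberField L] [IsCMField L]
  (μ : Measure (quasiSplit (↥(maximalRealSubfield L)) L (IsCMField.complexConj L) 2).automorphicQuotient) [IsFiniteMeasure μ]

/-- `Σ_{j∈s} a_j • [quotFun (E ψ_j)] = [quotFun (fun x ↦ Σ_{j∈s} a_j E ψ_j x)]` in `L²(X)` (induction on `s`; Mathlib `MemLp.toLp_add`, `toLp_const_smul`). [folklore] -/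
theorem sum_smul_toLp_eq {K : Type} [Field K] [NumberField K] (𝒢 : AdelicGroupData K) (μ : Measure 𝒢.automorphicQuotient) {ι' : Type*} [DecidableEq ι'] (s : Finset ι') (a' : ι' → ℂ)
    (Φ : ι' → 𝒢.Adelic → ℂ) (hv : ∀ j, MemLp (𝒢.quotFun (Φ j)) 2 μ) :
    ∃ hs : MemLp (𝒢.quotFun fun x => ∑ j ∈ s, a' j * Φ j x) 2 μ, (∑ j ∈ s, a' j • (hv j).toLp _) = hs.toLp _ := by
  induction s using Finset.induction_on with
  | empty =>
    refine ⟨?_, ?_⟩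
    · simp only [Finset.sum_empty]; exact MemLp.zero' 
    · simp only [Finset.sum_empty]
      exact (MemLp.toLp_zero _).symm
  | insert j s hj ih =>
    obtain ⟨hs, hseq⟩ := ih
    have hj' : MemLp (𝒢.quotFun fun x => a' j * Φ j x) 2 μ := by
      have h := (hv j).const_smul (a' j)
      exact h
    have hsum : MemLp (𝒢.quotFun fun x => ∑ i ∈ insert j s, a' i * Φ i x) 2 μ := by
      have h := hj'.add hs
      refine h.ae_eq (Eventually.of_forall fun x => ?_)
      simp only [Finset.sum_insert hj, Pi.add_apply]
      rfl
    refine ⟨hsum, ?_⟩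
    rw [Finset.sum_insert hj, hseq, ← MemLp.toLp_const_smul, ← MemLp.toLp_add]
    · exact MemLp.toLp_congr _ _ (Eventually.of_forall fun x => by simp only [Finset.sum_insert hj, Pi.add_apply, Pi.smul_apply, smul_eq_mul]; rfl)

/-- **THE `L²` TRANSFER**: for every `a > 0` there is `C ≥ 0` such that whenever `ψ` and finitely many `ψ_j` are left-`B(F)`-invariant, vanish where `H ≤ a`, and
`sup_g |ψ(g) − Σ_{j∈s} a_j ψ_j(g)| ≤ ε`, the `L²(X, μ)`-classes satisfy **`‖[quotFun (E ψ)] − Σ_{j∈s} a_j • [quotFun (E ψ_j)]‖ ≤ μ(X)^{1/2} · C · ε`**.  The estimate carrying ★ F3c's uniform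
approximation to `E^{K} ⊆ closure Σ_χ E^{K}_χ` (FILE F3d). [cite: MoeglinWaldspurger1995, II.1.2, I.2.2] [cite: BernsteinLapid2019, §4] -/
theorem exists_const_norm_toLp_sub_sum_le_cm {a : ℝ≥0} (ha : 0 < a) :
    ∃ C : ℝ, 0 ≤ C ∧ ∀ {ι' : Type} [DecidableEq ι'] (s : Finset ι') (a' : ι' → ℂ)
      (ψ : (quasiSplit (↥(maximalRealSubfield L)) L (IsCMField.complexConj L) 2).Adelic → ℂ) (ψ' : ι' → (quasiSplit (↥(maximalRealSubfield L)) L (IsCMField.complexConj L) 2).Adelic → ℂ)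
      (_ : ∀ b ∈ arithmeticBorel (↥(maximalRealSubfield L)) L (IsCMField.complexConj L) 2, ∀ x, ψ ((b : (quasiSplit (↥(maximalRealSubfield L)) L (IsCMField.complexConj L) 2).Adelic) * x) = ψ x)
      (_ : ∀ j, ∀ b ∈ arithmeticBorel (↥(maximalRealSubfield L)) L (IsCMField.complexConj L) 2, ∀ x, ψ' j ((b : (quasiSplit (↥(maximalRealSubfield L)) L (IsCMField.complexConj L) 2).Adelic) * x) = ψ' j x)
      (_ : ∀ g, borelHeight g ≤ a → ψ g = 0) (_ : ∀ j g, borelHeight g ≤ a → ψ' j g = 0) (ε : ℝ) (_ : ∀ g, ‖ψ g - ∑ j ∈ s, a' j * ψ' j g‖ ≤ ε)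
      (hv : MemLp ((quasiSplit (↥(maximalRealSubfield L)) L (IsCMField.complexConj L) 2).quotFun (eisensteinSeriesU ψ)) 2 μ)
      (hv' : ∀ j, MemLp ((quasiSplit (↥(maximalRealSubfield L)) L (IsCMField.complexConj L) 2).quotFun (eisensteinSeriesU (ψ' j))) 2 μ),
        ‖hv.toLp _ - ∑ j ∈ s, a' j • (hv' j).toLp _‖ ≤ (measureUnivNNReal μ : ℝ) ^ (2 : ℝ)⁻¹ * C * ε := by
  obtain ⟨C, hC0, hC⟩ := exists_const_norm_eisensteinSeriesU_le_cm L ha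
  refine ⟨C, hC0, fun {ι'} _ s a' ψ ψ' hψB hψ'B hψa hψ'a ε hε hv hv' => ?_⟩
  have hε0 : 0 ≤ ε := (norm_nonneg _).trans (hε 1)
  -- the difference class is `[quotFun (E δ)]`, `δ = ψ − Σ a_j ψ_j`
  obtain ⟨hs, hseq⟩ := sum_smul_toLp_eq (quasiSplit (↥(maximalRealSubfield L)) L (IsCMField.complexConj L) 2) μ s a' (fun j => eisensteinSeriesU (ψ' j)) hv'
  have hδ : (quasiSplit (↥(maximalRealSubfield L)) L (IsCMField.complexConj L) 2).quotFun (eisensteinSeriesU fun x => ψ x - ∑ j ∈ s, a' j * ψ' j x) =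
      (quasiSplit (↥(maximalRealSubfield L)) L (IsCMField.complexConj L) 2).quotFun (eisensteinSeriesU ψ) -
        (quasiSplit (↥(maximalRealSubfield L)) L (IsCMField.complexConj L) 2).quotFun (fun x => ∑ j ∈ s, a' j * eisensteinSeriesU (ψ' j) x) := by
    funext x
    simp only [AdelicGroupData.quotFun, Pi.sub_apply, eisensteinSeriesU_sub_finset_sum_of_band s a' hψB hψ'B ha hψa hψ'a]
  have hvδ : MemLp ((quasiSplit (↥(maximalRealSubfield L)) L (IsCMField.complexConj L) 2).quotFun (eisensteinSeriesU fun x => ψ x - ∑ j ∈ s, a' j * ψ' j x)) 2 μ := by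
    rw [hδ]; exact hv.sub hs
  have hcls : hv.toLp _ - ∑ j ∈ s, a' j • (hv' j).toLp _ = hvδ.toLp _ := by
    rw [hseq, ← MemLp.toLp_sub]
    exact MemLp.toLp_congr _ _ (Eventually.of_forall fun x => by rw [hδ])
  rw [hcls, mul_assoc]
  refine norm_toLp_quotFun_le_of_forall_norm_le _ μ (mul_nonneg hC0 hε0) (fun g => hC _ ?_ ?_ ε hε g) hvδ
  · intro b hb x
    simp only [hψB b hb x, hψ'B _ b hb x]
  · intro g hg
    simp only [hψa g hg, hψ'a _ g hg, mul_zero, Finset.sum_const_zero, sub_zero]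

end Transfer

end Summit.HodgeConjecture.HodgeConjecture.Cruxes.H413.K2E1EisensteinSupNormBandBoundCMTwo

end
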